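import Mathlib
import Literature.Computability.AlgebraicComplexity.NestFreeMatchingPoly
import Literature.Computability.AlgebraicComplexity.ArithCircuitProofs
import Summits.ValiantsHypothesis.ValiantsHypothesis.Theorems.FifoMatchingNNDivisionHardStackPowersQueue
import Summits.ValiantsHypothesis.ValiantsHypothesis.Theorems.FifoMatchingNNPowersNotCertificates
import Summits.ValiantsHypothesis.ValiantsHypothesis.Theorems.FifoMatchingNNSaturatedCofactors
import Summits.ValiantsHypothesis.ValiantsHypothesis.Theses.FifoMatching
import HarnessLib

/-!
# Route FifoMatching — crux `NNDivisionHard` (stmt-ValiantsHypothesis-21181): BLOCK TRANSPORT of certificates along the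
# pinned rainbow face, MIXED stack–queue powers, and the NON-GENERIC residual tier by name

Sequel of `…NNDivisionHardStackPowersQueue` (face identification `top_w(NN_n) = x^{pins} · ι(NN_a)`, `ι = blockEmb`, block
size `a` with `4a+2 ≤ 2n`, `n ≤ 3a+1`, pinned rainbow direction `w = prWeight n a = (n+1)·𝟙_R + 𝟙_{pins}`).  The face-reading
rung needs `top_w(h)` to be a monomial; here the monomial is allowed a LEFT-BLOCK FACTOR:

* ★ `complexity_transport` — **TRANSPORT RUNG** (the «face transport» step r2 of the hands' census): if
  `top_w(h) = x^β · ι(f)` for some exponent `β` and some polynomial `f` on the arcs of the left block `[0, 2a)`, then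
  `L₊(NN_a · f) ≤ 16((2n+1)(L₊(NN_n · h)+1))²` — a certificate for `NN_n` with cofactor `h` transports to a certificate for
  `NN_a` with cofactor `f` at polynomial cost (top components are free and multiplicative over `ℝ≥0`,
  `x^{pins}·ι(NN_a) · x^β·ι(f) = x^{pins+β} · ι(NN_a·f)`, Jukna–Seiwert–Sergeev stripping, injective renaming);
* `topComponent_pow`, `topComponent_noncrossingPow`, `topComponent_mixedPow` — `top_w(NN_n^j · NC_n^k) =
  x^{j·pins + k·χ_rev} · ι(c • NN_a^j)` (`c ≠ 0` the top coefficient of `NC_n^k`);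
* ★ `complexity_pow_le_of_mixedPow` — hence `L₊(NN_a^{j+1}) ≤ 16((2n+1)(L₊(NN_n · NN_n^j NC_n^k)+1))² + 1`;
* `qp_of_exp_le` — the quasi-polynomial bookkeeping for any quantity `X` with `2^{⌊(n+2)/3⌋^{1/6}} ≤ X ≤ 5184(2n+1)⁶(L+1)⁴`;
* ★★ `mixedPow_not_certificate_qp` — for every `c`, eventually in `n`, **for ALL `j, k`:
  `2^((log₂ n + c)^c) < L₊(NN_n · NN_n^j NC_n^k) + L₊(NN_n^j NC_n^k)`** (the crux inequality on the mixed stack–queue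
  power family, uniformly; `NNPowers.exp_lower_bound_pow` at scale `a`) — these cofactors are non-generic for `w` when
  `j ≥ 1`, so `…StackPowersQueue.generic_not_certificate_qp` did not cover them;
* ★★ `saturatedTransport_not_certificate_qp` — more generally every cofactor whose `w`-top face transports to a
  vertex-homogeneous SATURATED left-block factor `f` is not a certificate (`SaturatedCofactor.exp_lower_bound_saturated` at
  scale `a`);
* ★ `nnDivisionHard_iff_nonGenericTier` — BY NAME: `Theses.FifoMatching.NNDivisionHard` ⟺ the same inequality for the
  cofactors that are NOT generic in the pinned rainbow direction `prWeight n ⌊(n+2)/3⌋` (no unique `w`-maximal monomial).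

HONEST FRAMING: explicit cofactor families / a transport engine in the monotone world; the residual of stmt-21181 (cheap,
content-free, torus-homogeneous, hyper-degree, unsaturated, non-generic cofactors) stays OPEN (Hrubeš–Yehudayoff 2021 §6
Problem 2); nothing here bears on `NNNotVP` or on VP ≠ VNP (NOT proved).
References: Jukna–Seiwert–Sergeev 2022 Thm 1 [JuknaSeiwertSergeev2022]; Hrubeš–Yehudayoff 2021 §6 Problem 2
[HrubesYehudayoff2021]; Jerrum–Snir 1982 §4.3 [JerrumSnir1982].
-/

noncomputable section

-- Sub = Summit single-conjunct layout: the duplicated namespace component is mandated by the tree.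
set_option linter.dupNamespace false
set_option autoImplicit false

namespace Summit.ValiantsHypothesis.ValiantsHypothesis.Theorems.FifoMatching.NNDivisionHard.BlockTransport

open Finset MvPolynomial Literature.Computability.AlgebraicComplexity
open Summit.ValiantsHypothesis.ValiantsHypothesis.Theorems.ZeroOneTransfer.Negative
  (topComponent topComponent_mul topComponent_C complexity_topComponent_le)
open Summit.ValiantsHypothesis.ValiantsHypothesis.Theorems.FifoMatching.NNDivisionHard.FaceReading
  (topComponent_eq_monomial_of_unique_max)
open Summit.ValiantsHypothesis.ValiantsHypothesis.Theorems.FifoMatching.NNDivisionHard.StackPowers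
  (generic_noncrossingPow nsmul_rev_mem_support_noncrossingPow)
open Summit.ValiantsHypothesis.ValiantsHypothesis.Theorems.FifoMatching.NNDivisionHard.StackPowersQueue
  (prWeight pinWeight pinExp blockEmb blockEmb_injective topComponent_eq pinWeight_le_one prWeight_eq exponent_le
    generic_not_certificate_qp)
open Summit.ValiantsHypothesis.ValiantsHypothesis.Theorems.DivisionGap.PerCofactorDegreeReduction.MonomialStripping
  (complexity_le_of_monomial_mul)
open scoped NNReal BigOperators

variable {n a : ℕ}

/-! ### §1 The transport rung -/

/-- ★ **TRANSPORT RUNG.**  If the `w`-top face of the cofactor is `x^β · ι(f)` with `f` a polynomial on the left block, then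
`L₊(NN_a · f) ≤ 16((2n+1)(L₊(NN_n · h)+1))²`: the certificate transports to the left block at polynomial cost.
[cite: JuknaSeiwertSergeev2022, Thm 1] -/
theorem complexity_transport (h1 : 4 * a + 2 ≤ 2 * n) (h2 : n ≤ 3 * a + 1) (hle : 2 * a ≤ 2 * n)
    (h : MvPolynomial (Fin (2 * n) × Fin (2 * n)) ℝ≥0) {β : (Fin (2 * n) × Fin (2 * n)) →₀ ℕ}
    {f : MvPolynomial (Fin (2 * a) × Fin (2 * a)) ℝ≥0}
    (htop : topComponent (prWeight n a) h = monomial β 1 * rename (blockEmb hle) f) :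
    complexity (nestFreeMatchingPoly a ℝ≥0 * f) ≤
      16 * ((2 * n + 1) * (complexity (nestFreeMatchingPoly n ℝ≥0 * h) + 1)) ^ 2 := by
  have H := complexity_topComponent_le (prWeight n a) (nestFreeMatchingPoly n ℝ≥0 * h)
  rw [topComponent_mul, topComponent_eq h1 h2 hle, htop] at H
  have heq : monomial (pinExp n a) (1 : ℝ≥0) * rename (blockEmb hle) (nestFreeMatchingPoly a ℝ≥0) *
      (monomial β 1 * rename (blockEmb hle) f) =
      monomial (pinExp n a + β) 1 * rename (blockEmb hle) (nestFreeMatchingPoly a ℝ≥0 * f) := by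
    rw [map_mul, show monomial (pinExp n a + β) (1 : ℝ≥0) = monomial (pinExp n a) 1 * monomial β 1 by
      rw [monomial_mul, one_mul]]
    ring
  rw [heq] at H
  have hstrip := complexity_le_of_monomial_mul (2 * n) (pinExp n a + β)
    (rename (blockEmb hle) (nestFreeMatchingPoly a ℝ≥0 * f))
  rw [complexity_rename_of_injective_holds (blockEmb_injective hle)] at hstrip
  exact hstrip.trans (by gcongr)

/-! ### §2 Mixed stack–queue powers -/

/-- Top components of powers: `top_w(p^j) = (top_w p)^j` over `ℝ≥0`. [folklore] -/
theorem topComponent_pow {σ : Type*} (w : σ → ℕ) (p : MvPolynomial σ ℝ≥0) (j : ℕ) :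
    topComponent w (p ^ j) = (topComponent w p) ^ j := by
  induction j with
  | zero => rw [pow_zero, pow_zero, ← C_1, topComponent_C]
  | succ j ih => rw [pow_succ, pow_succ, topComponent_mul, ih]

/-- In the pinned rainbow direction the top component of `NC_n^k` is the monomial `c · x^{k·χ_rev}`, `c ≠ 0` its
coefficient. [folklore] -/
theorem topComponent_noncrossingPow (n a k : ℕ) :
    topComponent (prWeight n a) ((noncrossingMatchingPoly n ℝ≥0) ^ k) =
      monomial (k • arcExponent (Fin.rev : Fin (2 * n) → Fin (2 * n)))
        (coeff (k • arcExponent (Fin.rev : Fin (2 * n) → Fin (2 * n))) ((noncrossingMatchingPoly n ℝ≥0) ^ k)) := by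
  refine topComponent_eq_monomial_of_unique_max (prWeight n a) _ (nsmul_rev_mem_support_noncrossingPow n k)
    fun e' he' hne => ?_
  obtain ⟨hle, heq⟩ := generic_noncrossingPow (Nat.lt_succ_self n) (prWeight n a) (pinWeight n a)
    pinWeight_le_one prWeight_eq k e' he'
  rw [map_nsmul, smul_eq_mul]
  exact lt_of_le_of_ne hle fun h => hne (heq h)

/-- The top face of a mixed power `NN_n^j · NC_n^k` is `x^{j·pins + k·χ_rev} · ι(c • NN_a^j)`. [folklore] -/
theorem topComponent_mixedPow (h1 : 4 * a + 2 ≤ 2 * n) (h2 : n ≤ 3 * a + 1) (hle : 2 * a ≤ 2 * n) (j k : ℕ) :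
    topComponent (prWeight n a) ((nestFreeMatchingPoly n ℝ≥0) ^ j * (noncrossingMatchingPoly n ℝ≥0) ^ k) =
      monomial (j • pinExp n a + k • arcExponent (Fin.rev : Fin (2 * n) → Fin (2 * n))) 1 *
        rename (blockEmb hle)
          (coeff (k • arcExponent (Fin.rev : Fin (2 * n) → Fin (2 * n))) ((noncrossingMatchingPoly n ℝ≥0) ^ k) •
            (nestFreeMatchingPoly a ℝ≥0) ^ j) := by
  set c := coeff (k • arcExponent (Fin.rev : Fin (2 * n) → Fin (2 * n))) ((noncrossingMatchingPoly n ℝ≥0) ^ k)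
  rw [topComponent_mul, topComponent_pow, topComponent_eq h1 h2 hle, topComponent_noncrossingPow, mul_pow,
    monomial_pow, one_pow, ← map_pow, smul_eq_C_mul, map_mul, rename_C,
    show monomial (j • pinExp n a + k • arcExponent (Fin.rev : Fin (2 * n) → Fin (2 * n))) (1 : ℝ≥0) =
      monomial (j • pinExp n a) 1 * monomial (k • arcExponent (Fin.rev : Fin (2 * n) → Fin (2 * n))) 1 by
        rw [monomial_mul, one_mul],
    show monomial (k • arcExponent (Fin.rev : Fin (2 * n) → Fin (2 * n))) c =
      C c * monomial (k • arcExponent (Fin.rev : Fin (2 * n) → Fin (2 * n))) 1 by rw [C_mul_monomial, mul_one]]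
  ring

/-- ★ **Mixed powers transport to pure queue powers**: `L₊(NN_a^{j+1}) ≤ 16((2n+1)(L₊(NN_n · NN_n^j NC_n^k)+1))² + 1`.
[cite: JuknaSeiwertSergeev2022, Thm 1] -/
theorem complexity_pow_le_of_mixedPow (h1 : 4 * a + 2 ≤ 2 * n) (h2 : n ≤ 3 * a + 1) (j k : ℕ) :
    complexity ((nestFreeMatchingPoly a ℝ≥0) ^ (j + 1)) ≤
      16 * ((2 * n + 1) * (complexity (nestFreeMatchingPoly n ℝ≥0 *
        ((nestFreeMatchingPoly n ℝ≥0) ^ j * (noncrossingMatchingPoly n ℝ≥0) ^ k)) + 1)) ^ 2 + 1 := by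
  have hle : 2 * a ≤ 2 * n := by omega
  set c := coeff (k • arcExponent (Fin.rev : Fin (2 * n) → Fin (2 * n))) ((noncrossingMatchingPoly n ℝ≥0) ^ k)
    with hc_def
  have hc : c ≠ 0 := mem_support_iff.mp (nsmul_rev_mem_support_noncrossingPow n k)
  have HT := complexity_transport h1 h2 hle _ (topComponent_mixedPow h1 h2 hle j k)
  rw [← hc_def] at HT
  -- undo the scalar: `NN_a · (c • NN_a^j) = c • NN_a^{j+1}`
  have heq : nestFreeMatchingPoly a ℝ≥0 * (c • (nestFreeMatchingPoly a ℝ≥0) ^ j) =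
      c • (nestFreeMatchingPoly a ℝ≥0) ^ (j + 1) := by
    rw [mul_smul_comm, pow_succ']
  rw [heq] at HT
  have h3 : complexity ((nestFreeMatchingPoly a ℝ≥0) ^ (j + 1)) ≤
      complexity (c • (nestFreeMatchingPoly a ℝ≥0) ^ (j + 1)) + 1 := by
    have := complexity_smul_le_holds c⁻¹ (c • (nestFreeMatchingPoly a ℝ≥0) ^ (j + 1))
    rwa [smul_smul, inv_mul_cancel₀ hc, one_smul] at this
  omega

/-! ### §3 Quasi-polynomial readings -/

/-- Quasi-polynomial bookkeeping: for every `c`, eventually in `n`, any quantity `X` with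
`2^{⌊(n+2)/3⌋^{1/6}} ≤ X ≤ 5184(2n+1)⁶(L+1)⁴` forces `2^((log₂ n + c)^c) < L`. [folklore] -/
theorem qp_of_exp_le (c : ℕ) : ∃ n₀ : ℕ, ∀ n : ℕ, n₀ ≤ n → ∀ L X : ℕ,
    (2 : ℝ) ^ ((((n + 2) / 3 : ℕ) : ℝ) ^ ((1 : ℝ) / 6)) ≤ (X : ℝ) →
      X ≤ 5184 * (2 * n + 1) ^ 6 * (L + 1) ^ 4 → 2 ^ ((Nat.log 2 n + c) ^ c) < L := by
  obtain ⟨n₂, hn₂⟩ := CorSandwich.polylog_lt_rpow_eventually (c + 36) (c := 1 / 6) (by norm_num)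
  refine ⟨3 * n₂ + 7, fun n hn L X HR HA => ?_⟩
  set a := (n + 2) / 3 with ha
  have ha0 : a ≠ 0 := by omega
  set q := (Nat.log 2 n + c) ^ c with hq
  by_contra hcon
  push Not at hcon
  have hlogn : 2 * n + 1 ≤ 2 ^ (Nat.log 2 n + 2) := by
    have := Nat.lt_pow_succ_log_self Nat.one_lt_two n
    rw [pow_succ] at this ⊢
    omega
  have hq1 : 1 ≤ 2 ^ q := Nat.one_le_two_pow
  have hL1 : L + 1 ≤ 2 ^ (q + 1) := by rw [pow_succ]; omega
  have HB : X ≤ 2 ^ (4 * q + 6 * Nat.log 2 n + 29) :=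
    calc X ≤ 5184 * (2 * n + 1) ^ 6 * (L + 1) ^ 4 := HA
      _ ≤ 2 ^ 13 * (2 ^ (Nat.log 2 n + 2)) ^ 6 * (2 ^ (q + 1)) ^ 4 := by gcongr; norm_num
      _ = 2 ^ (4 * q + 6 * Nat.log 2 n + 29) := by ring
  have hlog : Nat.log 2 n ≤ Nat.log 2 a + 2 := by
    calc Nat.log 2 n ≤ Nat.log 2 (a * 2 * 2) := Nat.log_mono_right (by omega)
      _ = Nat.log 2 a + 2 := by
          rw [Nat.log_mul_base Nat.one_lt_two (by positivity), Nat.log_mul_base Nat.one_lt_two ha0]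
  have HE : 4 * q + 6 * Nat.log 2 n + 29 ≤ (Nat.log 2 a + (c + 36)) ^ (c + 36) := exponent_le c _ _ hlog
  have HC : X ≤ 2 ^ ((Nat.log 2 a + (c + 36)) ^ (c + 36)) := HB.trans (Nat.pow_le_pow_right Nat.two_pos HE)
  have HP := hn₂ a (by omega)
  have H : (2 : ℝ) ^ ((a : ℝ) ^ ((1 : ℝ) / 6)) ≤ (2 : ℝ) ^ ((((Nat.log 2 a + (c + 36)) ^ (c + 36) : ℕ) : ℝ)) := by
    calc (2 : ℝ) ^ ((a : ℝ) ^ ((1 : ℝ) / 6)) ≤ (X : ℝ) := HR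
      _ ≤ ((2 ^ ((Nat.log 2 a + (c + 36)) ^ (c + 36)) : ℕ) : ℝ) := by exact_mod_cast HC
      _ = (2 : ℝ) ^ ((((Nat.log 2 a + (c + 36)) ^ (c + 36) : ℕ) : ℝ)) := by
          rw [Nat.cast_pow, Nat.cast_ofNat, Real.rpow_natCast]
  have H' := (Real.rpow_le_rpow_left_iff one_lt_two).1 H
  linarith

/-- Arithmetic: the transport bound is below the face-reading bound. [folklore] -/
theorem sixteen_sq_le (n L : ℕ) :
    16 * ((2 * n + 1) * (L + 1)) ^ 2 + 1 ≤ 5184 * (2 * n + 1) ^ 6 * (L + 1) ^ 4 := by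
  have hy : 1 ≤ ((2 * n + 1) * (L + 1)) ^ 2 := Nat.one_le_pow _ _ (Nat.mul_pos (by omega) (by omega))
  have hx : 1 ≤ (2 * n + 1) ^ 2 := Nat.one_le_pow _ _ (by omega)
  calc 16 * ((2 * n + 1) * (L + 1)) ^ 2 + 1 ≤ 17 * ((2 * n + 1) * (L + 1)) ^ 2 := by omega
    _ = 17 * ((2 * n + 1) * (L + 1)) ^ 2 * 1 * 1 := by ring
    _ ≤ 5184 * ((2 * n + 1) * (L + 1)) ^ 2 * ((2 * n + 1) * (L + 1)) ^ 2 * (2 * n + 1) ^ 2 := by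
        gcongr; norm_num
    _ = 5184 * (2 * n + 1) ^ 6 * (L + 1) ^ 4 := by ring

/-- ★★ **MIXED STACK–QUEUE POWERS ARE NOT CERTIFICATES**: for every `c`, eventually in `n`, for ALL `j, k`,
`2^((log₂ n + c)^c) < L₊(NN_n · NN_n^j NC_n^k) + L₊(NN_n^j NC_n^k)` — the crux inequality of `Theses.FifoMatching.NNDivisionHard`
on the whole family `{NN_n^j NC_n^k}`, uniformly. [cite: JuknaSeiwertSergeev2022, Thm 1] [cite: JerrumSnir1982, §4.3] -/
theorem mixedPow_not_certificate_qp (c : ℕ) : ∃ n₀ : ℕ, ∀ n : ℕ, n₀ ≤ n → ∀ j k : ℕ,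
    2 ^ ((Nat.log 2 n + c) ^ c) <
      complexity (nestFreeMatchingPoly n ℝ≥0 *
          ((nestFreeMatchingPoly n ℝ≥0) ^ j * (noncrossingMatchingPoly n ℝ≥0) ^ k)) +
        complexity ((nestFreeMatchingPoly n ℝ≥0) ^ j * (noncrossingMatchingPoly n ℝ≥0) ^ k) := by
  obtain ⟨n₁, hn₁⟩ := NNPowers.exp_lower_bound_pow
  obtain ⟨n₀, hn₀⟩ := qp_of_exp_le c
  refine ⟨max n₀ (3 * n₁ + 7), fun n hn j k => ?_⟩
  have h1 : 4 * ((n + 2) / 3) + 2 ≤ 2 * n := by omega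
  have h2 : n ≤ 3 * ((n + 2) / 3) + 1 := by omega
  set L := complexity (nestFreeMatchingPoly n ℝ≥0 *
    ((nestFreeMatchingPoly n ℝ≥0) ^ j * (noncrossingMatchingPoly n ℝ≥0) ^ k)) with hL
  have HX := complexity_pow_le_of_mixedPow h1 h2 j k
  rw [← hL] at HX
  have HR := hn₁ ((n + 2) / 3) (by omega) (j + 1) (by omega)
  exact lt_of_lt_of_le (hn₀ n (le_of_max_le_left hn) L _ HR (HX.trans (sixteen_sq_le n L)))
    (Nat.le_add_right _ _)

/-- ★★ **SATURATED TRANSPORT**: for every `c`, eventually in `n`, every cofactor `h` whose top face in the pinned rainbow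
direction `prWeight n ⌊(n+2)/3⌋` is `x^β · ι(f)` with `f` vertex-homogeneous and SATURATED on the left block (every nest-free
perfect matching of `[0, 2a)` carries a monomial of `f`) satisfies `2^((log₂ n + c)^c) < L₊(NN_n · h) + L₊(h)`.
[cite: JerrumSnir1982, §4.3] [cite: JuknaSeiwertSergeev2022, Thm 1] -/
theorem saturatedTransport_not_certificate_qp (c : ℕ) : ∃ n₀ : ℕ, ∀ n : ℕ, n₀ ≤ n →
    ∀ (hle : 2 * ((n + 2) / 3) ≤ 2 * n) (h : MvPolynomial (Fin (2 * n) × Fin (2 * n)) ℝ≥0)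
      (β : (Fin (2 * n) × Fin (2 * n)) →₀ ℕ)
      (f : MvPolynomial (Fin (2 * ((n + 2) / 3)) × Fin (2 * ((n + 2) / 3))) ℝ≥0)
      (δ : Fin (2 * ((n + 2) / 3)) → ℕ),
      topComponent (prWeight n ((n + 2) / 3)) h = monomial β 1 * rename (blockEmb hle) f →
      (∀ e ∈ f.support, ∀ i, ∑ j, (e (i, j) + e (j, i)) = δ i) →
      (∀ P ∈ nestFreeMatchings (2 * ((n + 2) / 3)), ∃ e ∈ f.support, ∀ x, e x ≠ 0 → arcExponent P x ≠ 0) →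
        2 ^ ((Nat.log 2 n + c) ^ c) < complexity (nestFreeMatchingPoly n ℝ≥0 * h) + complexity h := by
  obtain ⟨n₁, hn₁⟩ := SaturatedCofactor.exp_lower_bound_saturated
  obtain ⟨n₀, hn₀⟩ := qp_of_exp_le c
  refine ⟨max n₀ (3 * n₁ + 7), fun n hn hle h β f δ htop hδ hsat => ?_⟩
  have h1 : 4 * ((n + 2) / 3) + 2 ≤ 2 * n := by omega
  have h2 : n ≤ 3 * ((n + 2) / 3) + 1 := by omega
  set L := complexity (nestFreeMatchingPoly n ℝ≥0 * h) with hL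
  have HX := complexity_transport h1 h2 hle h htop
  rw [← hL] at HX
  have HR := hn₁ ((n + 2) / 3) (by omega) f δ hδ hsat
  exact lt_of_lt_of_le (hn₀ n (le_of_max_le_left hn) L _ HR
    (le_trans (by omega) (HX.trans (Nat.le_succ _) |>.trans (sixteen_sq_le n L))))
    (Nat.le_add_right _ _)

/-! ### §4 The non-generic tier, by name -/

/-- ★ **`NNDivisionHard` ⟺ its NON-GENERIC tier.**  The crux holds iff, for every `c`, eventually in `n`, every nonzero
cofactor `h` with NO unique maximal monomial in the pinned rainbow direction `prWeight n ⌊(n+2)/3⌋` satisfies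
`2^((log₂ n + c)^c) < L₊(NN_n · h) + L₊(h)`; generic cofactors are dealt with by
`StackPowersQueue.generic_not_certificate_qp`. [cite: JuknaSeiwertSergeev2022, Thm 1] [cite: HrubesYehudayoff2021, §6 Problem 2] -/
theorem nnDivisionHard_iff_nonGenericTier :
    Summit.ValiantsHypothesis.ValiantsHypothesis.Theses.FifoMatching.NNDivisionHard ↔
    ∀ c : ℕ, ∃ n₀ : ℕ, ∀ n ≥ n₀, ∀ h : MvPolynomial (Fin (2 * n) × Fin (2 * n)) ℝ≥0, h ≠ 0 →
      (∀ e ∈ h.support, ∃ e' ∈ h.support, e' ≠ e ∧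
        Finsupp.weight (prWeight n ((n + 2) / 3)) e ≤ Finsupp.weight (prWeight n ((n + 2) / 3)) e') →
        2 ^ ((Nat.log 2 n + c) ^ c) < complexity (nestFreeMatchingPoly n ℝ≥0 * h) + complexity h := by
  constructor
  · intro H c
    obtain ⟨n₀, hn₀⟩ := H c
    exact ⟨n₀, fun n hn h hh _ => hn₀ n hn h hh⟩
  · intro H c
    obtain ⟨n₀, hn₀⟩ := H c
    obtain ⟨n₁, hn₁⟩ := generic_not_certificate_qp c
    refine ⟨max n₀ n₁, fun n hn h hh => ?_⟩
    show 2 ^ ((Nat.log 2 n + c) ^ c) < complexity (nestFreeMatchingPoly n ℝ≥0 * h) + complexity h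
    by_cases hgen : ∃ e ∈ h.support, ∀ e' ∈ h.support, e' ≠ e →
        Finsupp.weight (prWeight n ((n + 2) / 3)) e' < Finsupp.weight (prWeight n ((n + 2) / 3)) e
    · obtain ⟨e, he, hg⟩ := hgen
      exact hn₁ n (le_trans (le_max_right _ _) hn) h e he hg
    · push Not at hgen
      exact hn₀ n (le_trans (le_max_left _ _) hn) h hh hgen

end Summit.ValiantsHypothesis.ValiantsHypothesis.Theorems.FifoMatching.NNDivisionHard.BlockTransport

end
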